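import Summits.CriticalPhenomena.PercolationContinuityZ3.Theorems.PercNearOneGluingNoHeavyQuantBlobLoadUnits
import HarnessLib

/-!
# QUANT lane R8, T-DEC: FIVE EQUAL BLOBS WITH A COMMON GATE ARE HEAVY AT THAT GATE FOR EVERY `g ∈ (0,1)` — the band cell
# `2/5 < g < 1/2` by the uniform-spreading certificate (first kernel use of the flow of conjecture C), the rest by the two flanks
# (prim-quant-census-2 gen 82, file 6)

builds on p205010 (kernel theorem, internal audit signed; external expert review pending)

Support file (`--supports stmt-CriticalPhenomena-4575`), QUANT lane census seat prim-quant-census-2 (gen 82); memo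
`run/shared/lean/prim/quant/prim-quant-census-2-g82/REFLECTION-G82.md` §3.  Theorems only, standard axioms, no sorries, no definitions.

Conjecture BLOB-AFL (`…/prim-quant-census-2-g80/TRIPLE-G80.md` §5) for five EQUAL blobs `(k, g)`: the binomial blob law `blobLaw (replicate 5 (k,g))`
is heavy at floor `g` and target `5·k·g`.  `g ≤ 2/5` (blob mean `≤ 2k`) is `heavy_blobLaw_of_mean_le_two` (census-2 g81) and `g ≥ 1/2` is
`heavy_blobLaw_replicate_of_half_le` (g81) / `heavy_blobLaw_gates_of_half_le` (g82); the BAND CELL `2/5 < g < 1/2` (`2 < s = 5g < 5/2`, floor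
`x = g < 1/2`: neither flank applies) is closed here by the uniform-spreading certificate of `…QuantUniformSpread` in its `k`-free form
(`heavy_blobLaw_of_unitLoad_le_one`, `…QuantBlobLoadUnits`): lows `0` and `k`; the zero is served by the atoms `3k, 4k, 5k` at the credit gates
`5g/3, 5g/4, g`, the atom `k` by `2k..5k` at the floor `g`; the load is `5g·P₀/U + g·P₁/((1−g)(1−P₀−P₁))` with `P_j = C(5,j)g^j(1−g)^{5−j}`,
`U = Σ_{h≥3} P_h(h−5g)`, and `load ≤ 1 ⟺ g³(1−g)⁴·R(g) ≥ 0` with the quintic `R(g) = −50 + 200g − 175g² + 120g³ − 115g⁴ + 50g⁵ > 0` on `[2/5,1/2]`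
(`fiveBlobs_quintic_pos`; `R(2/5) = 906/125`; census value of the load: `0.635 … 0.379` on the cell, memo §3).
* `fiveBlobs_quintic_pos`, `fiveBlobs_load_le_one` (the closed-form load inequality), `sum_range_six`;
* **`heavy_blobLaw_replicate_five_band`** (`2/5 < g < 1/2`), **`heavy_blobLaw_replicate_five`** (every `0 < g < 1`), `decAtT_blobLaw_replicate_five`.
This is the first width beyond 4 at which BLOB-AFL is kernel for equal gates and EVERY gate; the family `(g,g,g,g,cg)` needed by the glued
quintuple (TRIPLE-G80 §5) and arbitrary gates remain open at width 5 (they are instances of conjecture C, memo §3).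

HONEST STATUS.  `SiblingStep`, `FarTreeRow`, `GluedLemmaW`, `GluedDominatedMass` OPEN; RATE class (log\*) / honest sentence of
`run/shared/lean/prim/quant/README.md` unchanged.  [this work].  Nothing here is cited as a published result.  The gluing rows served
[cite: KozmaNitzan2024, Conjecture 3 (p. 15)]; product measure [cite: Grimmett1999, §1.3 p. 10].
-/

noncomputable section

open scoped BigOperators

namespace Summit.CriticalPhenomena.PercolationContinuityZ3.Theorems
namespace Quant

open Finset

/-- the two-point law `{lo, hi; g}` (as in `…QuantLawDEC`) -/
local notation3 "TP[" lo ", " hi ", " g ", " h "]" =>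
  (g : ℝ) * (if (h : ℕ) = (hi : ℕ) then (1 : ℝ) else 0) + (1 - (g : ℝ)) * (if (h : ℕ) = (lo : ℕ) then (1 : ℝ) else 0)

/-- the cheapest admissible gate of the pair `{l, h}` at floor `x`, target `T`: `max(x, (T − 2l)/(h − l))` -/
local notation3 "CG[" x ", " T ", " l ", " h "]" => max (x : ℝ) (((T : ℝ) - 2 * ((l : ℕ) : ℝ)) / (((h : ℕ) : ℝ) - ((l : ℕ) : ℝ)))

/-- the Poisson-binomial point mass `P_G(j)`: the law of the blobs `(k, g)`, `g ∈ G`, at the atom `j·k` -/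
local notation3 "PB[" k ", " G ", " j "]" => LawDec.blobLaw (List.map (fun g : ℝ => ((k : ℕ), g)) G) ((j : ℕ) * (k : ℕ))

namespace LawDec

/-- the quintic of the band cell: `R(g) = −50 + 200g − 175g² + 120g³ − 115g⁴ + 50g⁵ > 0` on `[2/5, 1/2]`
(`R(2/5 + t) = 906/125 + (2364/25)t − (547/5)t² + 16t³ − 15t⁴ + 50t⁵`, `0 ≤ t ≤ 1/10`). [this work] -/
theorem fiveBlobs_quintic_pos {g : ℝ} (hg1 : 2 / 5 ≤ g) (hg2 : g ≤ 1 / 2) :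
    0 < -50 + 200 * g - 175 * g ^ 2 + 120 * g ^ 3 - 115 * g ^ 4 + 50 * g ^ 5 := by
  obtain ⟨t, rfl⟩ : ∃ t, g = 2 / 5 + t := ⟨g - 2 / 5, by ring⟩
  have ht0 : 0 ≤ t := by linarith
  have ht1 : t ≤ 1 / 10 := by linarith
  have key : -50 + 200 * (2 / 5 + t) - 175 * (2 / 5 + t) ^ 2 + 120 * (2 / 5 + t) ^ 3 - 115 * (2 / 5 + t) ^ 4 + 50 * (2 / 5 + t) ^ 5
      = 906 / 125 + 2364 / 25 * t - 547 / 5 * t ^ 2 + 16 * t ^ 3 - 15 * t ^ 4 + 50 * t ^ 5 := by ring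
  rw [key]
  have h2 : t ^ 2 ≤ t * (1 / 10) := by nlinarith
  have h4 : t ^ 4 ≤ t * (1 / 1000) := by nlinarith [pow_le_pow_left₀ ht0 ht1 3]
  nlinarith [pow_nonneg ht0 3, pow_nonneg ht0 5]


/-- the load inequality of the band cell in closed form: `P₀/T₀ + P₁/T₁ ≤ 1` for the binomial masses `P_j = C(5,j)g^j(1−g)^{5−j}`,
`T₀ = Σ_{i=3..5} P_i(1−γ₀ᵢ)/γ₀ᵢ` (`γ₀ᵢ = 5g/i`), `T₁ = Σ_{i=2..5} P_i(1−g)/g`. [this work] -/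
theorem fiveBlobs_load_le_one {g : ℝ} (hg1 : 2 / 5 < g) (hg2 : g < 1 / 2) :
    (1 - g) ^ 5 / (10 * g ^ 3 * (1 - g) ^ 2 * (1 - 5 * g / 3) / (5 * g / 3) + 5 * g ^ 4 * (1 - g) * (1 - 5 * g / 4) / (5 * g / 4)
        + g ^ 5 * (1 - g) / g)
      + 5 * g * (1 - g) ^ 4 / (10 * g ^ 2 * (1 - g) ^ 3 * (1 - g) / g + 10 * g ^ 3 * (1 - g) ^ 2 * (1 - g) / g
        + 5 * g ^ 4 * (1 - g) * (1 - g) / g + g ^ 5 * (1 - g) / g) ≤ 1 := by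
  have hg0 : 0 < g := by linarith
  have hu : 0 < 1 - g := by linarith
  have h3 : 0 < 3 - 5 * g := by linarith
  have h4 : 0 < 4 - 5 * g := by linarith
  have hq := fiveBlobs_quintic_pos hg1.le hg2.le
  -- the two spreading capacities in closed form
  have e0 : 10 * g ^ 3 * (1 - g) ^ 2 * (1 - 5 * g / 3) / (5 * g / 3) + 5 * g ^ 4 * (1 - g) * (1 - 5 * g / 4) / (5 * g / 4)
      + g ^ 5 * (1 - g) / g
      = (10 * g ^ 3 * (1 - g) ^ 2 * (3 - 5 * g) + 5 * g ^ 4 * (1 - g) * (4 - 5 * g) + 5 * g ^ 5 * (1 - g)) / (5 * g) := by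
    field_simp
  have e1 : 10 * g ^ 2 * (1 - g) ^ 3 * (1 - g) / g + 10 * g ^ 3 * (1 - g) ^ 2 * (1 - g) / g
      + 5 * g ^ 4 * (1 - g) * (1 - g) / g + g ^ 5 * (1 - g) / g
      = (1 - g) * (10 * g ^ 2 * (1 - g) ^ 3 + 10 * g ^ 3 * (1 - g) ^ 2 + 5 * g ^ 4 * (1 - g) + g ^ 5) / g := by
    field_simp
  have hU : 0 < 10 * g ^ 3 * (1 - g) ^ 2 * (3 - 5 * g) + 5 * g ^ 4 * (1 - g) * (4 - 5 * g) + 5 * g ^ 5 * (1 - g) := by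
    have t1 : 0 < 10 * g ^ 3 * (1 - g) ^ 2 * (3 - 5 * g) := mul_pos (by positivity) h3
    have t2 : 0 < 5 * g ^ 4 * (1 - g) * (4 - 5 * g) := mul_pos (by positivity) h4
    have t3 : 0 < 5 * g ^ 5 * (1 - g) := by positivity
    linarith
  have hW : 0 < (1 - g) * (10 * g ^ 2 * (1 - g) ^ 3 + 10 * g ^ 3 * (1 - g) ^ 2 + 5 * g ^ 4 * (1 - g) + g ^ 5) := by positivity
  rw [e0, e1, div_div_eq_mul_div, div_div_eq_mul_div, div_add_div _ _ hU.ne' hW.ne', div_le_one (mul_pos hU hW)]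
  have key : (10 * g ^ 3 * (1 - g) ^ 2 * (3 - 5 * g) + 5 * g ^ 4 * (1 - g) * (4 - 5 * g) + 5 * g ^ 5 * (1 - g))
        * ((1 - g) * (10 * g ^ 2 * (1 - g) ^ 3 + 10 * g ^ 3 * (1 - g) ^ 2 + 5 * g ^ 4 * (1 - g) + g ^ 5))
      - ((1 - g) ^ 5 * (5 * g) * ((1 - g) * (10 * g ^ 2 * (1 - g) ^ 3 + 10 * g ^ 3 * (1 - g) ^ 2 + 5 * g ^ 4 * (1 - g) + g ^ 5))
        + (10 * g ^ 3 * (1 - g) ^ 2 * (3 - 5 * g) + 5 * g ^ 4 * (1 - g) * (4 - 5 * g) + 5 * g ^ 5 * (1 - g))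
          * (5 * g * (1 - g) ^ 4 * g))
      = g ^ 3 * (1 - g) ^ 4 * (-50 + 200 * g - 175 * g ^ 2 + 120 * g ^ 3 - 115 * g ^ 4 + 50 * g ^ 5) := by
    ring
  nlinarith [mul_nonneg (mul_nonneg (pow_nonneg hg0.le 3) (pow_nonneg hu.le 4)) hq.le]

/-- six-term range sum. [folklore] -/
theorem sum_range_six (F : ℕ → ℝ) : ∑ i ∈ Finset.range 6, F i = F 0 + F 1 + F 2 + F 3 + F 4 + F 5 := by
  simp only [Finset.sum_range_succ, Finset.sum_range_zero, zero_add]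

/-- **FIVE EQUAL BLOBS IN THE BAND CELL `2/5 < g < 1/2` ARE HEAVY AT THEIR COMMON GATE** (floor `g`, target `5·k·g`): the uniform-spreading
load is `5g·P₀/U + g·P₁/((1−g)(1−P₀−P₁)) ≤ 1`, i.e. `g³(1−g)⁴·R(g) ≥ 0` with the quintic `R` of `fiveBlobs_quintic_pos`. [this work] -/
theorem heavy_blobLaw_replicate_five_band (k : ℕ) (hk : 0 < k) {g : ℝ} (hg1 : 2 / 5 < g) (hg2 : g < 1 / 2) :
    ∃ (ι : Type) (_ : Fintype ι) (lam γ : ι → ℝ) (lo hi : ι → ℕ),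
      (∀ i, 0 ≤ lam i) ∧ (∑ i, lam i = 1) ∧ (∀ i, 0 ≤ γ i ∧ γ i ≤ 1) ∧ (∀ i, lo i ≤ hi i) ∧ (∀ i, hi i ≤ 5 * k) ∧
      (∀ h, blobLaw (List.replicate 5 (k, g)) h = ∑ i, lam i * TP[lo i, hi i, γ i, h]) ∧
      (∀ i, 0 < lam i → g ≤ γ i ∧ (5 : ℝ) * k * g ≤ 2 * (lo i : ℝ) + ((hi i : ℝ) - lo i) * γ i) := by
  have hG : ∀ x ∈ List.replicate 5 g, 0 < x ∧ x < 1 := fun x hx => by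
    rw [List.eq_of_mem_replicate hx]; exact ⟨by linarith, by linarith⟩
  have hS : (List.replicate 5 g).sum = 5 * g := by
    simp only [List.replicate, List.sum_cons, List.sum_nil]; ring
  have hL : (List.replicate 5 g).length = 5 := by simp
  have hM : List.map (fun g : ℝ => (k, g)) (List.replicate 5 g) = List.replicate 5 (k, g) := by simp
  have key := heavy_blobLaw_of_unitLoad_le_one k hk (List.replicate 5 g) hG (by rw [hL]; norm_num) ?_
  · rw [hS, hL, hM] at key
    have e1 : (5 : ℝ) * g / ((5 : ℕ) : ℝ) = g := by push_cast; ring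
    have e2 : (k : ℝ) * (5 * g) = (5 : ℝ) * k * g := by ring
    rw [e1, e2] at key
    exact key
  · -- the load inequality of the cell
    rw [hS, hL, hM, sum_range_six]
    push_cast
    -- the lows are `j = 0, 1`
    rw [if_pos (by linarith : (2 : ℝ) * 0 < 5 * g), if_pos (by linarith : (2 : ℝ) * 1 < 5 * g),
      if_neg (by linarith : ¬ (2 : ℝ) * 2 < 5 * g), if_neg (by linarith : ¬ (2 : ℝ) * 3 < 5 * g),
      if_neg (by linarith : ¬ (2 : ℝ) * 4 < 5 * g), if_neg (by linarith : ¬ (2 : ℝ) * 5 < 5 * g),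
      add_zero, add_zero, add_zero, add_zero]
    -- the admissible highs: `i ≥ 3` for `j = 0`, `i ≥ 2` for `j = 1`
    rw [sum_range_six, sum_range_six]
    push_cast
    rw [if_neg (by linarith : ¬ (5 : ℝ) * g - 0 < 0), if_neg (by linarith : ¬ (5 : ℝ) * g - 0 < 1),
      if_neg (by linarith : ¬ (5 : ℝ) * g - 0 < 2), if_pos (by linarith : (5 : ℝ) * g - 0 < 3),
      if_pos (by linarith : (5 : ℝ) * g - 0 < 4), if_pos (by linarith : (5 : ℝ) * g - 0 < 5),
      if_neg (by linarith : ¬ (5 : ℝ) * g - 1 < 0), if_neg (by linarith : ¬ (5 : ℝ) * g - 1 < 1),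
      if_pos (by linarith : (5 : ℝ) * g - 1 < 2), if_pos (by linarith : (5 : ℝ) * g - 1 < 3),
      if_pos (by linarith : (5 : ℝ) * g - 1 < 4), if_pos (by linarith : (5 : ℝ) * g - 1 < 5)]
    simp only [zero_add]
    -- the cheapest gates: credit gates `5g/i` for the zero, the floor `g` for the low atom `k`
    have m03 : max (5 * g / 5) ((5 * g - 2 * 0) / (3 - 0)) = 5 * g / 3 := by
      rw [max_eq_right (by norm_num; linarith)]; ring
    have m04 : max (5 * g / 5) ((5 * g - 2 * 0) / (4 - 0)) = 5 * g / 4 := by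
      rw [max_eq_right (by norm_num; linarith)]; ring
    have m05 : max (5 * g / 5) ((5 * g - 2 * 0) / (5 - 0)) = g := by
      rw [max_eq_right (by norm_num)]; ring
    have m12 : max (5 * g / 5) ((5 * g - 2 * 1) / (2 - 1)) = g := by
      rw [max_eq_left (by norm_num; linarith)]; ring
    have m13 : max (5 * g / 5) ((5 * g - 2 * 1) / (3 - 1)) = g := by
      rw [max_eq_left (by norm_num; linarith)]; ring
    have m14 : max (5 * g / 5) ((5 * g - 2 * 1) / (4 - 1)) = g := by
      rw [max_eq_left (by norm_num; linarith)]; ring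
    have m15 : max (5 * g / 5) ((5 * g - 2 * 1) / (5 - 1)) = g := by
      rw [max_eq_left (by norm_num; linarith)]; ring
    rw [m03, m04, m05, m12, m13, m14, m15]
    -- the binomial masses
    have hb : ∀ j : ℕ, blobLaw [((k : ℕ), g), (k, g), (k, g), (k, g), (k, g)] (j * k)
        = (Nat.choose 5 j : ℝ) * g ^ j * (1 - g) ^ (5 - j) := fun j => blobLaw_replicate k hk g 5 j
    rw [hb 0, hb 1, hb 2, hb 3, hb 4, hb 5]
    rw [show (Nat.choose 5 0 : ℝ) = 1 by norm_num [Nat.choose], show (Nat.choose 5 1 : ℝ) = 5 by norm_num [Nat.choose],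
      show (Nat.choose 5 2 : ℝ) = 10 by norm_num [Nat.choose], show (Nat.choose 5 3 : ℝ) = 10 by norm_num [Nat.choose],
      show (Nat.choose 5 4 : ℝ) = 5 by norm_num [Nat.choose], show (Nat.choose 5 5 : ℝ) = 1 by norm_num [Nat.choose]]
    norm_num only [pow_zero, pow_one, mul_one, one_mul, Nat.sub_self, Nat.sub_zero]
    exact fiveBlobs_load_le_one hg1 hg2

/-- **FIVE EQUAL BLOBS WITH A COMMON GATE `g ∈ (0,1)` ARE HEAVY AT FLOOR `g`, TARGET `5·k·g` — EVERY `g`, EVERY `k ≥ 1`** (conjecture BLOB-AFL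
at width 5 for equal gates): `g ≤ 2/5` by the zero-only-low lemma (`heavy_blobLaw_of_mean_le_two`, blob mean `5kg ≤ 2k`), `2/5 < g < 1/2` by the
uniform-spreading certificate (`heavy_blobLaw_replicate_five_band`), `g ≥ 1/2` by reflection (`heavy_blobLaw_replicate_of_half_le`). [this work] -/
theorem heavy_blobLaw_replicate_five (k : ℕ) (hk : 0 < k) {g : ℝ} (hg0 : 0 < g) (hg1 : g < 1) :
    ∃ (ι : Type) (_ : Fintype ι) (lam γ : ι → ℝ) (lo hi : ι → ℕ),
      (∀ i, 0 ≤ lam i) ∧ (∑ i, lam i = 1) ∧ (∀ i, 0 ≤ γ i ∧ γ i ≤ 1) ∧ (∀ i, lo i ≤ hi i) ∧ (∀ i, hi i ≤ 5 * k) ∧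
      (∀ h, blobLaw (List.replicate 5 (k, g)) h = ∑ i, lam i * TP[lo i, hi i, γ i, h]) ∧
      (∀ i, 0 < lam i → g ≤ γ i ∧ (5 : ℝ) * k * g ≤ 2 * (lo i : ℝ) + ((hi i : ℝ) - lo i) * γ i) := by
  have hk' : (0 : ℝ) < k := by exact_mod_cast hk
  rcases le_or_gt g (2 / 5) with hle | hlt
  · -- zero-only-low flank
    have hl : ∀ p ∈ List.replicate 5 (k, g), p.1 = k ∧ 0 ≤ p.2 ∧ p.2 ≤ 1 := fun p hp => by
      rw [List.eq_of_mem_replicate hp]; exact ⟨rfl, hg0.le, hg1.le⟩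
    have htop : blobTop (List.replicate 5 (k, g)) = 5 * k := blobTop_replicate 5 k g
    have hmean : blobMean (List.replicate 5 (k, g)) = (5 : ℝ) * k * g := by
      rw [blobMean_replicate]; push_cast; ring
    have hm0 : 0 < blobMean (List.replicate 5 (k, g)) := by rw [hmean]; positivity
    have hm2 : blobMean (List.replicate 5 (k, g)) ≤ 2 * k := by rw [hmean]; nlinarith
    have key := heavy_blobLaw_of_mean_le_two k _ hl hm0 hm2
    rw [hmean, htop] at key
    have e : (5 : ℝ) * k * g / ((5 * k : ℕ) : ℝ) = g := by push_cast; field_simp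
    rw [e] at key
    exact key
  · rcases lt_or_ge g (1 / 2) with hlt2 | hge
    · exact heavy_blobLaw_replicate_five_band k hk hlt hlt2
    · -- reflection flank
      have key := heavy_blobLaw_replicate_of_half_le 5 k hge hg1
      push_cast at key
      exact key

/-- **hence DEC at every layer** for five equal blobs with any common gate `g ∈ (0,1)`. [this work] -/
theorem decAtT_blobLaw_replicate_five (k : ℕ) (hk : 0 < k) {g : ℝ} (hg0 : 0 < g) (hg1 : g < 1) (j : ℕ) :
    DECAtT g ((5 : ℝ) * k * g) j (5 * k) (blobLaw (List.replicate 5 (k, g))) :=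
  decAtT_of_heavy _ _ _ _ (heavy_blobLaw_replicate_five k hk hg0 hg1) j

end LawDec
end Quant
end Summit.CriticalPhenomena.PercolationContinuityZ3.Theorems
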